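import Literature.Computability.QuantumComplexity.GeneratedOracleCircuits
import Literature.Computability.Cryptography.ClassBQPReductionProofs
import Literature.Computability.Complexity.OracleJoin
import HarnessLib

/-!
# `BQP` is closed under the join (marked union) of two languages

Topic `Literature/Computability/QuantumComplexity`. The join `A ⊕ B = {0w | w ∈ A} ∪ {1w | w ∈ B}`
(`Complexity.oracleJoin`, `Complexity/OracleJoin.lean`; Homer–Selman 2011, §7.3) of two `BQP` languages
is in `BQP`: **`oracleJoin_mem_BQP`** `: A ∈ BQP → B ∈ BQP → A ⊕ B ∈ BQP` — the two-component closure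
property consumed by classical `BPP^{BQP}` wraps calling TWO different quantum subroutines through ONE
oracle language (`Cryptography.isQSolvable_of_mem_FPRel_BQP`). Printed sources treat it as immediate from
`BQP^BQP = BQP` (Bennett–Bernstein–Brassard–Vazirani 1997, Cor. 4.15; Bernstein–Vazirani 1997, §8:
polynomial-time classical control calling `BQP` subroutines), and that is the proof formalised here,
through the tree's generated-circuit form of Cor. 4.15 (`isQSolvable_of_generated_oracle_circuits`): on
input `z` a polynomial-time generator prints a Clifford+`T` circuit WITH ORACLE GATES FOR `A`
(`BQPJoin.circ`):

* `z = 0w`: the word of `X = HSSH` gates writing `z` on the wires `0 … |w|` (wire `0` stays `0`, `w` sits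
  on the wires `1 … |w|`), then ONE oracle gate querying the wires `1 … |w|` with answer wire `0` — which
  then reads `[w ∈ A]` with probability `1` (`placeGate_oracleGate_mulVec_basisState`);
* `z = 1w`: the same `X` word, then the gates of the `|z|`-th circuit of an oracle-free uniform family `F`
  deciding the shifted language `tailLang B = {z | z.tail ∈ B}` (in `BQP` by the Karp closure
  `mem_PromiseBQP_of_polyTimeReducible`) with error `≤ 1/4` (`exists_uniform_family_inv_poly_error`,
  BBBV Thm. 4.13) — wire `0` reads `[w ∈ B]` with probability `≥ 3/4 = 2/3 + 1/12`; deciding the SHIFTED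
  language on `z` itself keeps the register nonempty and the written input equal to `|z⟩|0…0⟩`;
* `z = ε`: the empty one-wire circuit (wire `0` reads `0 = [ε ∈ A ⊕ B]`).

The description `(1^{k z}, rawGates)` is assembled in the typed `FP` algebra (`BQPJoin.codeFP_gen`: the
`X` word by a `flatMap` over the wire range, the oracle gate as one raw gate, the `B`-branch verbatim from
the raw description of `F`, `codeFP_rawDesc`), the post-processor reads the first measured bit
(`PadDecider.firstBitF`), and `mem_BQP_of_isQSolvable_bit` turns the resulting `FBQP` bit function into
membership. Everything is proved; no named fact. NOT here: closure under union/intersection of `BQP`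
languages (same method, not needed by the consumers), relativised versions.

## References

* C. H. Bennett, E. Bernstein, G. Brassard, U. Vazirani, *Strengths and weaknesses of quantum computing*,
  SIAM J. Comput. 26 (1997) 1510–1523, Thm. 4.13, Cor. 4.15 (`BQP^BQP = BQP`)
  [BennettBernsteinBrassardVazirani1997].
* E. Bernstein, U. Vazirani, *Quantum complexity theory*, SIAM J. Comput. 26 (1997), §8
  [BernsteinVazirani1997].
* S. Homer, A. L. Selman, *Computability and Complexity Theory*, 2nd ed., Springer 2011, §7.3 (the join
  `X ⊕ Y`) [HomerSelman2011].
* M. A. Nielsen, I. L. Chuang, *Quantum Computation and Quantum Information*, CUP 2010, §4.2 Ex. 4.18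
  (`X = HZH`), §6.1.1 (the oracle gate) [NielsenChuang2010].
-/

noncomputable section

namespace Literature.Computability.QuantumComplexity

open _root_.Computability Complexity Complexity.CodeFP Cryptography Matrix

/-! ### The shifted language -/

/-- The **shifted language** `{z | z.tail ∈ B}`: membership of `b w` is membership of `w` in `B`
(and of `ε` that of `ε`). [folklore] -/
def tailLang (B : Language Bool) : Language Bool := {z | z.tail ∈ B}

/-- Membership in the shifted language (definitional). [folklore] -/
@[simp] theorem mem_tailLang_iff (B : Language Bool) (z : List Bool) : z ∈ tailLang B ↔ z.tail ∈ B := Iff.rfl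

/-- **`BQP` is closed under the shift**: `tailLang B ≤ₚ B` by `List.tail ∈ FP` (Karp closure of
`PromiseBQP`, trivial promises). [cite: BernsteinVazirani1997, §8 (classical computation inside quantum machines)] -/
theorem tailLang_mem_BQP {B : Language Bool} (hB : B ∈ BQP) : tailLang B ∈ BQP := by
  rw [← ofLanguage_mem_PromiseBQP_iff] at hB ⊢
  exact mem_PromiseBQP_of_polyTimeReducible ⟨List.tail, PRelSigma.tail_mem_FP, fun _ hz => hz, fun _ hz => hz⟩ hB

namespace BQPJoin

/-! ### Words of `X` gates writing a string on the first wires -/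

section XWords

variable {N : ℕ}

/-- `X = HSSH` on each listed wire, in order. [cite: NielsenChuang2010, §4.2 Ex. 4.18] -/
def xWords (ws : List (Fin N)) : List (QGate cliffordT N) := ws.flatMap xWord

-- adapted from `Cryptography.VDSCopy.xWords_mulVec_basisState` (`Cryptography/VDSCopyConst.lean`), which is not
-- imported: that module sits on the van Dam–Seroussi/Shor cone (30 modules outside the imports of this generic file).
/-- **A word of `X` gates flips each wire once per occurrence** (generic copy of the van Dam–Seroussi
instance `VDSCopy.xWords_mulVec_basisState`, kept import-light). [cite: NielsenChuang2010, §4.2 Ex. 4.18] -/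
theorem xWords_mulVec_basisState (A : Language Bool) : ∀ (ws : List (Fin N)) (z : QReg N),
    (⟨xWords ws⟩ : QCircuit cliffordT N).toMatrix A *ᵥ basisState z = basisState (fun w => (z w ^^ (ws.count w).bodd))
  | [], z => by
    rw [xWords, List.flatMap_nil, QCircuit.toMatrix_nil, Matrix.one_mulVec]
    congr 1; funext w; simp
  | w₀ :: ws, z => by
    have hsplit : (⟨xWords (w₀ :: ws)⟩ : QCircuit cliffordT N) = (⟨xWord w₀⟩ : QCircuit cliffordT N).append ⟨xWords ws⟩ := by
      simp [xWords, QCircuit.append]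
    rw [hsplit, QCircuit.toMatrix_append, ← Matrix.mulVec_mulVec, xWord_mulVec_basisState, xWords_mulVec_basisState A ws]
    congr 1; funext w
    rw [List.count_cons]
    by_cases h : w₀ = w
    · subst h
      simp only [Function.update_self, beq_self_eq_true, if_true, Nat.bodd_succ]
      cases z w₀ <;> cases (List.count w₀ ws).bodd <;> rfl
    · rw [Function.update_of_ne (Ne.symm h)]
      simp [h]

/-- The wires to flip in order to write `z` on the first wires of an `N`-wire register. [folklore] -/
def onWires (N : ℕ) (z : List Bool) : List (Fin N) := (List.finRange N).filter fun i => z.getD i false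

/-- **Writing the input**: the `X` word of `onWires N z` turns `|0…0⟩` into `|z 0…0⟩` (bit `i` of the
register is `z[i]`, `0` beyond `|z|`). [cite: NielsenChuang2010, §4.2 Ex. 4.18] -/
theorem xWords_onWires_mulVec (A : Language Bool) (N : ℕ) (z : List Bool) :
    (⟨xWords (onWires N z)⟩ : QCircuit cliffordT N).toMatrix A *ᵥ basisState (fun _ => false) =
      basisState fun i => z.getD i false := by
  rw [xWords_mulVec_basisState]
  congr 1; funext i
  have hnd : (onWires N z).Nodup := (List.nodup_finRange N).filter _
  by_cases hm : i ∈ onWires N z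
  · rw [List.count_eq_one_of_mem hnd hm, (List.mem_filter.1 hm).2]; rfl
  · have hz : z.getD i false = false := by simpa [onWires] using hm
    rw [List.count_eq_zero.2 hm, hz]; rfl

/-- The padded input `|z⟩|0^m⟩` as a bit function of the wire index. [folklore] -/
theorem padInput_get_eq (z : List Bool) (m : ℕ) :
    padInput z.get m = fun i : Fin (z.length + m) => z.getD (i : ℕ) false := by
  funext i
  unfold padInput
  induction i using Fin.addCases with
  | left j => rw [Fin.append_left]; simp [List.getD_eq_getElem?_getD]
  | right j => rw [Fin.append_right]; simp [List.getD_eq_getElem?_getD]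

/-- The raw `X` word on wire `i`: `H, S, S, H` (symbol codes `0, 1, 1, 0`). [folklore] -/
def xRaw (i : ℕ) : List RawGate := [(false, 0, [i]), (false, 1, [i]), (false, 1, [i]), (false, 0, [i])]

/-- The raw gates of a word of `X` gates. [folklore] -/
theorem map_toRaw_xWords (ws : List (Fin N)) : (xWords ws).map QGate.toRaw = ws.flatMap fun i : Fin N => xRaw i := by
  rw [xWords, List.map_flatMap]; rfl

/-- A filtered `flatMap` is a conditional `flatMap`. [folklore] -/
theorem flatMap_filter_eq {α β : Type*} (p : α → Bool) (f : α → List β) (l : List α) :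
    (l.filter p).flatMap f = l.flatMap fun a => if p a then f a else [] := by
  induction l with
  | nil => rfl
  | cons a l ih =>
    rw [List.filter_cons, List.flatMap_cons, ← ih]
    cases p a <;> simp

/-- **The raw gates of the input-writing word**: for each wire `i < N` with `z[i] = 1`, the raw `X` word. [folklore] -/
theorem map_toRaw_xWords_onWires (N : ℕ) (z : List Bool) : (xWords (onWires N z)).map QGate.toRaw =
    (List.range N).flatMap fun i => if z.getD i false then xRaw i else [] := by
  rw [map_toRaw_xWords, onWires, flatMap_filter_eq]
  exact UExec.flatMap_finRange_eq N fun i => if z.getD i false then xRaw i else []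

end XWords

/-! ### The generated circuits -/

variable (F : QCircuitFamily cliffordT)

/-- The number of wires of the generated circuit on input `z`: one for `ε`, `|z|` on the `A`-side,
`|z| +` the ancillas of `F` on the `B`-side. [folklore] -/
def kOf : List Bool → ℕ
  | [] => 1
  | false :: w => w.length + 1
  | true :: w => (w.length + 1) + F.ancillas (w.length + 1)

/-- The placement of the oracle gate: query wires `1, …, n`, answer wire `0` (the rotation of
`Fin (n + 1)`). [folklore] -/
def rot (n : ℕ) : Fin (n + 1) ↪ Fin (n + 1) := (finRotate (n + 1)).toEmbedding

/-- **The generated circuit on input `z`** (BBBV, Cor. 4.15, for the join): write `z` by `X` gates;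
then nothing (`z = ε`), one oracle gate for `A` on the query `w` with answer wire `0` (`z = 0w`), or
the gates of `F.circ |z|` (`z = 1w`). [cite: BennettBernsteinBrassardVazirani1997, Cor. 4.15] -/
def circ : (z : List Bool) → QCircuit cliffordT (kOf F z)
  | [] => ⟨[]⟩
  | false :: w => ⟨xWords (onWires (w.length + 1) (false :: w)) ++ [QGate.oracle w.length (rot w.length)]⟩
  | true :: w => ⟨xWords (onWires _ (true :: w)) ++ (F.circ (w.length + 1)).gates⟩

/-- The answer bit `[z ∈ A ⊕ B]`, by cases on the tag. [cite: HomerSelman2011, §7.3] -/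
def bitOf (A B : Language Bool) : List Bool → Bool
  | [] => false
  | false :: w => A.boolIndicator w
  | true :: w => B.boolIndicator w

/-- `bitOf` is the indicator of the join. [cite: HomerSelman2011, §7.3] -/
theorem bitOf_eq_true_iff (A B : Language Bool) (z : List Bool) : bitOf A B z = true ↔ z ∈ oracleJoin A B := by
  rcases z with _ | ⟨_ | _, w⟩
  · simp [bitOf]
  · rw [bitOf, false_cons_mem_oracleJoin]; exact (Set.mem_iff_boolIndicator A w).symm
  · rw [bitOf, true_cons_mem_oracleJoin]; exact (Set.mem_iff_boolIndicator B w).symm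

/-- Every generated circuit has a wire. [folklore] -/
theorem one_le_kOf (z : List Bool) : 1 ≤ kOf F z := by
  rcases z with _ | ⟨_ | _, w⟩ <;> simp [kOf]
  omega

/-! ### The raw description and its generator -/

/-- The raw gates after the `X` word: none, the oracle gate `(1, |w|, [1, …, |w|, 0])`, or the raw gates
of `F.circ |z|`. [folklore] -/
def tailRaws (z : List Bool) : List RawGate :=
  if z.isEmpty then [] else if z.headD false then (F.circ z.length).rawGates
  else [(true, z.length - 1, (List.range z.length).tail ++ [0])]

/-- The wire numerals of the rotated placement: `1, …, n, 0`. [folklore] -/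
theorem ofFn_val_rot (n : ℕ) : (List.ofFn fun i => ((rot n i : Fin (n + 1)) : ℕ)) = (List.range (n + 1)).tail ++ [0] := by
  rw [List.ofFn_succ', List.range_succ_eq_map, List.tail_cons, List.concat_eq_append]
  congr 1
  · rw [List.ofFn_eq_map, ← List.map_coe_finRange_eq_range, List.map_map]
    refine List.map_congr_left fun i _ => ?_
    show ((finRotate (n + 1)) i.castSucc : ℕ) = (i : ℕ) + 1
    rw [coe_finRotate_of_ne_last (Fin.castSucc_lt_last i).ne]
    rfl
  · show [((finRotate (n + 1)) (Fin.last n) : ℕ)] = [0]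
    rw [finRotate_last]; rfl

/-- The wire count in closed form. [folklore] -/
theorem kOf_eq (z : List Bool) :
    kOf F z = if z.isEmpty then 1 else if z.headD false then z.length + F.ancillas z.length else z.length := by
  rcases z with _ | ⟨_ | _, w⟩ <;> rfl

/-- **The raw description of the generated circuit**: the conditional `X` words over the wire range,
then `tailRaws`. [folklore] -/
theorem rawGates_circ (z : List Bool) : (circ F z).rawGates =
    ((List.range (kOf F z)).flatMap fun i => if z.getD i false then xRaw i else []) ++ tailRaws F z := by
  rcases z with _ | ⟨_ | _, w⟩
  · simp [circ, kOf, tailRaws, QCircuit.rawGates]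
  · show (xWords (onWires (w.length + 1) (false :: w)) ++ [QGate.oracle w.length (rot w.length)]).map QGate.toRaw =
      ((List.range (w.length + 1)).flatMap fun i => if (false :: w).getD i false then xRaw i else []) ++
        [((true, (w.length + 1) - 1, (List.range (w.length + 1)).tail ++ [0]) : RawGate)]
    rw [List.map_append, map_toRaw_xWords_onWires, List.map_singleton, Nat.add_sub_cancel, ← ofFn_val_rot]
    rfl
  · show (xWords (onWires _ (true :: w)) ++ (F.circ (w.length + 1)).gates).map QGate.toRaw =
      ((List.range ((w.length + 1) + F.ancillas (w.length + 1))).flatMap fun i =>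
        if (true :: w).getD i false then xRaw i else []) ++ (F.circ (w.length + 1)).rawGates
    rw [List.map_append, map_toRaw_xWords_onWires]
    rfl

/-- The raw `X` word is computed on codes from the wire numeral. [folklore] -/
theorem codeFP_xRaw : CodeFP natE (rawE RawGate.E) xRaw := by
  have hg : ∀ c : ℕ, CodeFP natE RawGate.E (fun i => ((false, c, [i]) : RawGate)) := fun c =>
    (RawGate.codeFP_mk.comp (((const natE false).pair ((const natE c).pair
      ((listOfRaw natE).comp (rawSingleton natE)))) :)).congr fun _ => rfl
  exact (((rawCons RawGate.E).comp ((hg 0).pair ((rawCons RawGate.E).comp ((hg 1).pair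
    ((rawCons RawGate.E).comp ((hg 1).pair ((rawSingleton RawGate.E).comp (hg 0)))))))).congr fun _ => rfl :)

/-- **The generator is polynomial time**: `z ↦ (1^{k z}, rawGates (circ z))` on codes, for a uniform `F`
(Arora–Barak 2009, Remark 6.7: the description of a uniform family is printed in polynomial time).
[cite: BennettBernsteinBrassardVazirani1997, Cor. 4.15 (the running time of the simulation)] -/
theorem codeFP_gen (hU : F.IsUniform) : CodeFP strE UExec.tcE fun z => (kOf F z, (circ F z).rawGates) := by
  have cLen : CodeFP strE unE List.length := strLength
  have cNatLen : CodeFP strE natE List.length := strNatLength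
  have cEmpty : CodeFP strE bitE List.isEmpty :=
    (natEq.comp (cNatLen.pair (const strE 0))).congr fun z => by cases z <;> simp
  have cHead : CodeFP strE bitE fun z => z.headD false :=
    ⟨HashBricks.headBitFn, HashBricks.headBitFn_mem_FP, fun z => by rw [HashBricks.headBitFn_apply]; rfl⟩
  have cDesc : CodeFP strE RawDesc.E fun z => F.rawDesc z.length := (codeFP_rawDesc hU).comp cLen
  have cAnc : CodeFP strE unE fun z => F.ancillas z.length := cDesc.snd'.fst'
  have cFr : CodeFP strE (rawE RawGate.E) fun z => (F.circ z.length).rawGates := cDesc.snd'.snd'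
  have cK : CodeFP strE unE (kOf F) :=
    (cEmpty.ite (const strE 1) (cHead.ite (unAdd.comp (cLen.pair cAnc)) cLen)).congr fun z => (kOf_eq F z).symm
  have cBody : CodeFP (pairE strE natE) (rawE RawGate.E) fun p => if p.1.getD p.2 false then xRaw p.2 else [] :=
    strGetDNat.ite (codeFP_xRaw.comp (snd strE natE)) (const _ [])
  have cX : CodeFP strE (rawE RawGate.E) fun z => (List.range (kOf F z)).flatMap fun i =>
      if z.getD i false then xRaw i else [] :=
    UExec.flatMapRange (F := fun z i => if z.getD i false then xRaw i else []) cK cBody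
  have cWires : CodeFP strE (listE natE) fun z => (List.range z.length).tail ++ [0] :=
    (listOfRaw natE).comp ((rawAppend natE).comp (((rawTail natE).comp (urange.comp cLen)).pair (const strE [0])))
  have cOracle : CodeFP strE RawGate.E fun z => ((true, z.length - 1, (List.range z.length).tail ++ [0]) : RawGate) :=
    (RawGate.codeFP_mk.comp ((const strE true).pair ((natSub.comp (cNatLen.pair (const strE 1))).pair cWires))).congr
      fun _ => rfl
  have cTail : CodeFP strE (rawE RawGate.E) (tailRaws F) :=
    (cEmpty.ite (const strE []) (cHead.ite cFr ((rawSingleton RawGate.E).comp cOracle))).congr fun z => rfl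
  exact (cK.pair ((rawAppend RawGate.E).comp (cX.pair cTail))).congr fun z => by dsimp only; rw [rawGates_circ]

/-! ### The output statistics of the three branches -/

/-- The first measured bit of a nonempty register. [folklore] -/
theorem headD_ofFn {N : ℕ} (hN : 0 < N) (f : QReg N) : (List.ofFn f).headD false = f ⟨0, hN⟩ := by
  cases N with | zero => exact absurd hN (lt_irrefl 0) | succ n => rw [List.ofFn_succ]; rfl

/-- A circuit mapping `|0…0⟩` to the basis state `|W⟩` yields an event containing `W` with probability `1`.
[cite: NielsenChuang2010, §2.2.5 (Born rule)] -/
theorem probEvent_eq_one_of_basisState {N : ℕ} (A : Language Bool) (C : QCircuit cliffordT N) {W : QReg N}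
    (h : C.toMatrix A *ᵥ basisState (fun _ => false) = basisState W) {E : Set (QReg N)} (hW : W ∈ E) :
    C.probEvent A (basisState fun _ => false) E = 1 := by
  classical
  unfold QCircuit.probEvent QCircuit.runOn
  rw [h, Finset.sum_eq_single_of_mem W (Finset.mem_filter.2 ⟨Finset.mem_univ _, hW⟩) fun y _ hy => by
    rw [basisState_apply, if_neg hy, norm_zero, zero_pow two_ne_zero]]
  simp

/-- **The empty query**: the one-wire empty circuit leaves wire `0` at `0`. [folklore] -/
theorem probEvent_circ_nil (A : Language Bool) :
    (circ F []).probEvent A (basisState fun _ => false) {f | f ⟨0, one_le_kOf F []⟩ = false} = 1 :=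
  probEvent_eq_one_of_basisState A _ (by rw [circ, QCircuit.toMatrix_nil, Matrix.one_mulVec]) rfl

/-- **The `A`-side**: after writing `0w` and the oracle gate (query wires `1 … |w|`, answer wire `0`),
wire `0` reads `[w ∈ A]` with probability `1`. [cite: NielsenChuang2010, §6.1.1 Eq. (6.2)] -/
theorem probEvent_circ_false (A : Language Bool) (w : List Bool) :
    (circ F (false :: w)).probEvent A (basisState fun _ => false)
      {f | f ⟨0, one_le_kOf F (false :: w)⟩ = A.boolIndicator w} = 1 := by
  refine probEvent_eq_one_of_basisState A _ (W := oracleTarget A (rot w.length) fun i => (false :: w).getD i false) ?_ ?_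
  · show ((⟨xWords (onWires (w.length + 1) (false :: w))⟩ : QCircuit cliffordT _).append
      ⟨[QGate.oracle w.length (rot w.length)]⟩).toMatrix A *ᵥ basisState (fun _ => false) = _
    rw [QCircuit.toMatrix_append, ← Matrix.mulVec_mulVec, xWords_onWires_mulVec, QCircuit.toMatrix_cons,
      QCircuit.toMatrix_nil, Matrix.one_mul, QGate.toMatrix_oracle, placeGate_oracleGate_mulVec_basisState]
  · have hlast : rot w.length (Fin.last w.length) = ⟨0, Nat.succ_pos _⟩ := finRotate_last
    have hq : queryOf (rot w.length) (fun i => (false :: w).getD i false) = w := by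
      unfold queryOf
      apply List.ext_getElem (by simp)
      intro i h₁ h₂
      rw [List.getElem_ofFn]
      show (false :: w).getD ((finRotate (w.length + 1)) (Fin.castSucc ⟨i, by simpa using h₁⟩) : ℕ) false = w[i]
      rw [coe_finRotate_of_ne_last (Fin.castSucc_lt_last _).ne]
      show (false :: w).getD (i + 1) false = w[i]
      rw [List.getD_cons_succ, List.getD_eq_getElem _ _ h₂]
    show oracleTarget A (rot w.length) (fun i => (false :: w).getD i false) ⟨0, Nat.succ_pos _⟩ = A.boolIndicator w
    rw [oracleTarget, hlast, Function.update_self, hq]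
    exact Bool.false_xor _

/-- **The `B`-side**: after writing `1w`, the gates of `F.circ |z|` run on `|z⟩|0…0⟩`.
[cite: NielsenChuang2010, §4.5 (the circuit model)] -/
theorem toMatrix_circ_true_mulVec (A : Language Bool) (hfree : F.IsOracleFree) (w : List Bool) :
    (circ F (true :: w)).toMatrix A *ᵥ basisState (fun _ => false) =
      (F.circ (w.length + 1)).toMatrix 0 *ᵥ basisState (padInput (true :: w).get (F.ancillas (w.length + 1))) := by
  show ((⟨xWords (onWires _ (true :: w))⟩ : QCircuit cliffordT ((w.length + 1) + F.ancillas (w.length + 1))).append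
      (F.circ (w.length + 1))).toMatrix A *ᵥ basisState (fun _ => false) = _
  rw [QCircuit.toMatrix_append, ← Matrix.mulVec_mulVec, xWords_onWires_mulVec,
    QCircuit.toMatrix_eq_of_isOracleFree (hfree _) A 0, padInput_get_eq]
  rfl

/-- On the `B`-side the probability that wire `0` reads `b` is the Born mass `wireZeroMass` of the
family's run on `|z⟩|0…0⟩`. [cite: NielsenChuang2010, §2.2.5 (Born rule)] -/
theorem probEvent_circ_true (A : Language Bool) (hfree : F.IsOracleFree) (w : List Bool) (b : Bool) :
    (circ F (true :: w)).probEvent A (basisState fun _ => false) {f | f ⟨0, one_le_kOf F (true :: w)⟩ = b} =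
      wireZeroMass ((F.circ (w.length + 1)).runOn 0 (basisState (padInput (true :: w).get (F.ancillas (w.length + 1))))) b := by
  classical
  have hpos : 0 < (w.length + 1) + F.ancillas (w.length + 1) := one_le_kOf F (true :: w)
  unfold QCircuit.probEvent wireZeroMass QCircuit.runOn
  rw [toMatrix_circ_true_mulVec F A hfree w, Finset.sum_filter]
  refine Finset.sum_congr rfl fun y _ => ?_
  simp only [Set.mem_setOf_eq]
  by_cases hy : y ⟨0, hpos⟩ = b
  · rw [if_pos hy, if_pos ⟨hpos, hy⟩]
  · rw [if_neg hy, if_neg fun ⟨_, h⟩ => hy h]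

/-- **The success probability of every generated circuit is `≥ 3/4`**, for `F` deciding `tailLang B` with
error `≤ 1/4`: `1` on `ε` and on the `A`-side, `≥ 3/4` on the `B`-side. [cite: BennettBernsteinBrassardVazirani1997, Thm. 4.13 and Cor. 4.15] -/
theorem probEvent_circ_ge (A B : Language Bool) (hfree : F.IsOracleFree)
    (hF : ∀ x : List Bool, (x ∈ tailLang B → 3 / 4 ≤ F.acceptProbOn 0 x) ∧ (x ∉ tailLang B → F.acceptProbOn 0 x ≤ 1 / 4))
    (z : List Bool) :
    2 / 3 + 1 / 12 ≤ (circ F z).probEvent A (basisState fun _ => false)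
      {f | PadDecider.firstBitF (boolPair z (List.ofFn f)) ∈ {y | [bitOf A B z] <+: y}} := by
  have hE : {f : QReg (kOf F z) | PadDecider.firstBitF (boolPair z (List.ofFn f)) ∈ {y | [bitOf A B z] <+: y}} =
      {f | f ⟨0, one_le_kOf F z⟩ = bitOf A B z} := by
    ext f
    simp only [Set.mem_setOf_eq, PadDecider.firstBitF_boolPair, headD_ofFn (one_le_kOf F z), List.cons_prefix_cons,
      List.prefix_rfl, and_true, eq_comm]
  rw [hE]
  rcases z with _ | ⟨_ | _, w⟩
  · rw [show bitOf A B [] = false from rfl, probEvent_circ_nil]; norm_num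
  · rw [show bitOf A B (false :: w) = A.boolIndicator w from rfl, probEvent_circ_false]; norm_num
  · rw [show bitOf A B (true :: w) = B.boolIndicator w from rfl, probEvent_circ_true F A hfree w]
    have hacc : F.acceptProbOn 0 (true :: w) =
        wireZeroMass ((F.circ (w.length + 1)).runOn 0 (basisState (padInput (true :: w).get (F.ancillas (w.length + 1))))) true :=
      acceptProb_eq_wireZeroMass _ _
    have hsum := wireZeroMass_true_add_false QCircuit.outputPMF_apply_holds cliffordT_isUnitary_holds
      (F.circ (w.length + 1)) (true :: w).get (one_le_kOf F (true :: w))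
    by_cases hw : w ∈ B
    · rw [(Set.mem_iff_boolIndicator B w).1 hw, ← hacc]
      linarith [(hF (true :: w)).1 hw]
    · rw [(Set.notMem_iff_boolIndicator B w).1 hw]
      linarith [(hF (true :: w)).2 hw]

end BQPJoin

/-! ### The theorem -/

/-- **`BQP` is closed under join (marked union).** If `A, B ∈ BQP` then
`A ⊕ B = {0w | w ∈ A} ∪ {1w | w ∈ B} ∈ BQP`: a uniform decider for the shifted language `{z | z.tail ∈ B}`
with error `≤ 1/4` (BBBV Thm. 4.13), the polynomial-time generated circuits `BQPJoin.circ` with one oracle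
gate for `A` on the `A`-side, oracle removal and execution (`isQSolvable_of_generated_oracle_circuits`,
BBBV Cor. 4.15 `BQP^BQP = BQP`), and decision from the written bit (`mem_BQP_of_isQSolvable_bit`).
[cite: BennettBernsteinBrassardVazirani1997, Cor. 4.15 (BQP^BQP = BQP)]
[cite: BernsteinVazirani1997, §8] -/
theorem oracleJoin_mem_BQP {A B : Language Bool} (hA : A ∈ BQP) (hB : B ∈ BQP) : oracleJoin A B ∈ BQP := by
  obtain ⟨F, hfree, hU, hF⟩ := exists_uniform_family_inv_poly_error (tailLang_mem_BQP hB)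
  have hquarter : ∀ x : List Bool, 1 / (4 * ((x.length : ℝ) + 1) ^ 2) ≤ 1 / 4 := fun x =>
    div_le_div_of_nonneg_left zero_le_one (by norm_num) (by nlinarith [Nat.cast_nonneg (α := ℝ) x.length])
  have hF' : ∀ x : List Bool, (x ∈ tailLang B → 3 / 4 ≤ F.acceptProbOn 0 x) ∧ (x ∉ tailLang B → F.acceptProbOn 0 x ≤ 1 / 4) :=
    fun x => ⟨fun hx => by linarith [(hF x).1 hx, hquarter x], fun hx => ((hF x).2 hx).trans (hquarter x)⟩
  have hsolv : IsQSolvable fun z => {y | [BQPJoin.bitOf A B z] <+: y} :=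
    isQSolvable_of_generated_oracle_circuits hA (fun _ _ _ hy hyz => List.IsPrefix.trans hy hyz) (BQPJoin.circ F)
      (BQPJoin.one_le_kOf F) (BQPJoin.codeFP_gen F hU) PadDecider.firstBitF PadDecider.firstBitF_mem_FP
      (δ := 1 / 12) (by norm_num) (BQPJoin.probEvent_circ_ge F A B hfree hF')
  exact mem_BQP_of_isQSolvable_bit (fun _ _ => QCircuit.outputPMF_apply_holds) cliffordT_isUnitary_holds
    (BQPJoin.bitOf_eq_true_iff A B) hsolv

end Literature.Computability.QuantumComplexity

end
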